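import Summits.AtomisticToContinuum.HydrodynamicLimit.Theorems.JParityClosureParityRigidityIdentify
import HarnessLib

/-!
# Diagonal parity rigidity (stub S3c-b `stub_diagonalParityRigidity`, line `preshock-kinetic-slaving`,
# crux `JParityClosure.EvenStressEnskog`, stmt-AtomisticToContinuum-13079) — identification of limits from
# vanishing Gaussian energy

The endgame of the energy route to the missing diagonal estimate (companion of the landed
`…DiagonalParityRigidityEnergy`: `∫ ‖μ̂ - λ̂‖² dγ_τ = I(μ,μ) - 2I(μ,λ) + I(λ,λ)`).  Along the diagonal the width
`ϑ_n → 0`, i.e. the temperature `τ_n = ϑ_n^{-2} → ∞` of the reference Maxwellian `γ_{τ_n}`, so a vanishing energy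
must be renormalised by `(2πτ_n)^{d/2}` to be seen on bounded frequency balls:

* `setIntegral_ball_le_mul_integral_gaussian` : `∫_{‖w‖<K} f ≤ (2πτ)^{d/2} e^{K²/(2τ)} ∫ f dγ_τ` for bounded
  continuous `f ≥ 0` (the Maxwellian density is `≥ (2πτ)^{-d/2} e^{-K²/(2τ)}` on the ball);
* `measure_eq_of_tendsto_setIntegral_norm_charFun_sub_sq` : finite measures `μ_n, λ_n` of bounded mass whose
  characteristic functions converge pointwise to those of `μ, λ` and satisfy
  `∫_{‖w‖<K} ‖μ̂_n - λ̂_n‖² dw → 0` for every `K` have `μ = λ` (dominated convergence, continuity,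
  `Measure.ext_of_charFun`);
* `measure_eq_of_tendsto_gaussianEnergy` (registered sub-goal `stub_diagonalParityRigidity_identification` is
  its instance on the pair space): the same under `(2πτ_n)^{d/2} ∫ ‖μ̂_n - λ̂_n‖² dγ_{τ_n} → 0`, `τ_n ≥ 1` — with
  the energy identity this is the statement "renormalised Gaussian energy of `ν_n - T̂_# ν_n` tends to zero and
  `ν_n ⇀ ν` imply `T̂_# ν = ν`", to be fed by the (missing) de-weighted defect estimate
  `(2π)^{d} ∫ a_n (1 - e^{-F_n}) dν_n → 0` (`a_n = ν_n ∗ G_{ϑ_n²}`; equal to the renormalised energy by the landed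
  Bochner representation).

References: S. Bochner (1932) §20; P. Billingsley, *Convergence of Probability Measures* (1999) §5 (characteristic
functions and weak limits).
-/

noncomputable section

open scoped InnerProductSpace Topology ENNReal NNReal ComplexConjugate
open MeasureTheory Filter Set Metric Real Complex
open Literature.Analysis.FluidPDE
open Summit.AtomisticToContinuum.HydrodynamicLimit.Theorems.ParityRigidity

namespace Summit.AtomisticToContinuum.HydrodynamicLimit.Theorems.EvenStressEnskog

section Identification

variable {F : Type*} [NormedAddCommGroup F] [InnerProductSpace ℝ F] [FiniteDimensional ℝ F]
  [MeasurableSpace F] [BorelSpace F]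

omit [FiniteDimensional ℝ F] [MeasurableSpace F] [BorelSpace F] in
/-- Lower bound of the centred Maxwellian density on a ball:
`(2πτ)^{-d/2} e^{-K²/(2τ)} ≤ M_{1,0,τ}(w)` for `‖w‖ < K`. [folklore] -/
theorem localMaxwellian_ge_on_ball {τ K : ℝ} (hτ : 0 < τ) {w : F} (hw : w ∈ ball (0 : F) K) :
    (2 * π * τ) ^ (-(Module.finrank ℝ F : ℝ) / 2) * Real.exp (-K ^ 2 / (2 * τ)) ≤
      localMaxwellian 1 τ 0 w := by
  unfold localMaxwellian
  rw [one_mul, sub_zero]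
  have hwK : ‖w‖ < K := by simpa using hw
  have hK : ‖w‖ ^ 2 ≤ K ^ 2 := by
    have := norm_nonneg w
    nlinarith
  gcongr

/-- **From the Gaussian reference measure to frequency balls.**  For a bounded continuous `f ≥ 0`,
`∫_{‖w‖<K} f dw ≤ (2πτ)^{d/2} e^{K²/(2τ)} ∫ f dγ_τ`, `γ_τ` the centred Maxwellian law of temperature `τ`.
[folklore] -/
theorem setIntegral_ball_le_mul_integral_gaussian {τ : ℝ} (hτ : 0 < τ) (K : ℝ) {f : F → ℝ}
    (hf : Continuous f) (hf0 : ∀ w, 0 ≤ f w) {B : ℝ} (hfB : ∀ w, f w ≤ B) :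
    ∫ w in ball (0 : F) K, f w ∂(volume : Measure F) ≤
      (2 * π * τ) ^ ((Module.finrank ℝ F : ℝ) / 2) * Real.exp (K ^ 2 / (2 * τ)) *
        ∫ w, f w ∂((volume : Measure F).withDensity fun w => ENNReal.ofReal (localMaxwellian 1 τ 0 w)) := by
  set c : ℝ := (2 * π * τ) ^ (-(Module.finrank ℝ F : ℝ) / 2) * Real.exp (-K ^ 2 / (2 * τ)) with hc
  have hcpos : 0 < c := by positivity
  have hcinv : c⁻¹ = (2 * π * τ) ^ ((Module.finrank ℝ F : ℝ) / 2) * Real.exp (K ^ 2 / (2 * τ)) := by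
    rw [hc, mul_inv, ← Real.rpow_neg (by positivity), ← Real.exp_neg, neg_div, neg_neg, neg_div, neg_neg]
  -- the `γ`-integral as a Lebesgue integral against the density
  have hρm : Measurable fun w : F => localMaxwellian 1 τ 0 w := (continuous_localMaxwellian τ 0).measurable
  have hγ : ∫ w, f w ∂((volume : Measure F).withDensity fun w => ENNReal.ofReal (localMaxwellian 1 τ 0 w)) =
      ∫ w, localMaxwellian 1 τ 0 w * f w ∂(volume : Measure F) := by
    rw [integral_withDensity_eq_integral_toReal_smul₀ hρm.ennreal_ofReal.aemeasurable
      (Eventually.of_forall fun _ => ENNReal.ofReal_lt_top)]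
    refine integral_congr_ae (Eventually.of_forall fun w => ?_)
    show (ENNReal.ofReal (localMaxwellian 1 τ 0 w)).toReal • f w = localMaxwellian 1 τ 0 w * f w
    rw [ENNReal.toReal_ofReal (localMaxwellian_pos hτ 0 w).le, smul_eq_mul]
  have hρf : Integrable (fun w => localMaxwellian 1 τ 0 w * f w) (volume : Measure F) :=
    (integrable_localMaxwellian hτ 0).mul_bdd hf.aestronglyMeasurable
      (Eventually.of_forall fun w => by
        rw [Real.norm_eq_abs, abs_of_nonneg (hf0 w)]
        exact hfB w)
  have hfi : IntegrableOn f (ball (0 : F) K) (volume : Measure F) :=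
    (integrableOn_const (C := B) (measure_ball_lt_top).ne).mono' hf.aestronglyMeasurable.restrict
      (Eventually.of_forall fun w => by
        rw [Real.norm_eq_abs, abs_of_nonneg (hf0 w)]
        exact hfB w)
  calc ∫ w in ball (0 : F) K, f w ∂(volume : Measure F)
      ≤ ∫ w in ball (0 : F) K, c⁻¹ * (localMaxwellian 1 τ 0 w * f w) ∂(volume : Measure F) := by
        refine setIntegral_mono_on hfi (hρf.const_mul _).integrableOn measurableSet_ball fun w hw => ?_
        have h1 : c ≤ localMaxwellian 1 τ 0 w := localMaxwellian_ge_on_ball hτ hw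
        calc f w = c⁻¹ * (c * f w) := by field_simp
          _ ≤ c⁻¹ * (localMaxwellian 1 τ 0 w * f w) :=
              mul_le_mul_of_nonneg_left (mul_le_mul_of_nonneg_right h1 (hf0 w)) (inv_nonneg.2 hcpos.le)
    _ = c⁻¹ * ∫ w in ball (0 : F) K, localMaxwellian 1 τ 0 w * f w ∂(volume : Measure F) :=
        integral_const_mul _ _
    _ ≤ c⁻¹ * ∫ w, localMaxwellian 1 τ 0 w * f w ∂(volume : Measure F) :=
        mul_le_mul_of_nonneg_left (setIntegral_le_integral hρf (Eventually.of_forall fun w =>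
          mul_nonneg (localMaxwellian_pos hτ 0 w).le (hf0 w))) (inv_nonneg.2 hcpos.le)
    _ = _ := by rw [hcinv, hγ]

/-- **Identification of limits from frequency balls.**  Let `μ_n, λ_n` be finite measures of total mass `≤ M`
whose characteristic functions converge pointwise to those of the finite measures `μ, λ`.  If
`∫_{‖w‖<K} ‖μ̂_n - λ̂_n‖² dw → 0` for every `K`, then `μ = λ`. [folklore] -/
theorem measure_eq_of_tendsto_setIntegral_norm_charFun_sub_sq (μs κs : ℕ → Measure F)
    (μ ν : Measure F) [IsFiniteMeasure μ] [IsFiniteMeasure ν] (hμs : ∀ n, IsFiniteMeasure (μs n))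
    (hκs : ∀ n, IsFiniteMeasure (κs n)) {M : ℝ} (hμM : ∀ n, (μs n).real Set.univ ≤ M)
    (hkM : ∀ n, (κs n).real Set.univ ≤ M)
    (hμ : ∀ w, Tendsto (fun n => charFun (μs n) w) atTop (𝓝 (charFun μ w)))
    (hν : ∀ w, Tendsto (fun n => charFun (κs n) w) atTop (𝓝 (charFun ν w)))
    (hK : ∀ K : ℝ, Tendsto (fun n => ∫ w in ball (0 : F) K, ‖charFun (μs n) w - charFun (κs n) w‖ ^ 2
      ∂(volume : Measure F)) atTop (𝓝 0)) :
    μ = ν := by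
  have hcont : Continuous fun w => ‖charFun μ w - charFun ν w‖ ^ 2 :=
    (continuous_charFun.sub continuous_charFun).norm.pow 2
  -- on every ball the limit defect vanishes
  have hball : ∀ K : ℝ, ∫ w in ball (0 : F) K, ‖charFun μ w - charFun ν w‖ ^ 2 ∂(volume : Measure F) = 0 := by
    intro K
    have hlim : Tendsto (fun n => ∫ w in ball (0 : F) K, ‖charFun (μs n) w - charFun (κs n) w‖ ^ 2
        ∂(volume : Measure F)) atTop
        (𝓝 (∫ w in ball (0 : F) K, ‖charFun μ w - charFun ν w‖ ^ 2 ∂(volume : Measure F))) := by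
      refine tendsto_integral_of_dominated_convergence (fun _ => (M + M) ^ 2) (fun n => ?_)
        (integrableOn_const (measure_ball_lt_top).ne) (fun n => Eventually.of_forall fun w => ?_)
        (Eventually.of_forall fun w => ?_)
      · haveI := hμs n; haveI := hκs n
        exact ((continuous_charFun.sub continuous_charFun).norm.pow 2).aestronglyMeasurable
      · haveI := hμs n; haveI := hκs n
        rw [Real.norm_eq_abs, abs_of_nonneg (sq_nonneg _)]
        have h0 : 0 ≤ M := le_trans measureReal_nonneg (hμM n)
        gcongr
        exact (norm_sub_le _ _).trans (add_le_add ((norm_charFun_le w).trans (hμM n))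
          ((norm_charFun_le w).trans (hkM n)))
      · exact (((hμ w).sub (hν w)).norm.pow 2)
    exact tendsto_nhds_unique hlim (hK K)
  -- hence the limit defect vanishes a.e. on every ball, everywhere by continuity
  have hzero : ∀ w, ‖charFun μ w - charFun ν w‖ ^ 2 = 0 := by
    have hae : ∀ K : ℝ, ∀ᵐ w ∂(volume : Measure F), w ∈ ball (0 : F) K →
        ‖charFun μ w - charFun ν w‖ ^ 2 = 0 := by
      intro K
      have hfi : IntegrableOn (fun w => ‖charFun μ w - charFun ν w‖ ^ 2) (ball (0 : F) K)
          (volume : Measure F) :=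
        (integrableOn_const (C := (μ.real Set.univ + ν.real Set.univ) ^ 2)
          (measure_ball_lt_top).ne).mono' hcont.aestronglyMeasurable.restrict
          (Eventually.of_forall fun w => by
            rw [Real.norm_eq_abs, abs_of_nonneg (sq_nonneg _)]
            gcongr
            exact (norm_sub_le _ _).trans (add_le_add (norm_charFun_le w) (norm_charFun_le w)))
      have h := (setIntegral_eq_zero_iff_of_nonneg_ae (Eventually.of_forall fun w => sq_nonneg _)
        hfi).1 (hball K)
      exact (ae_restrict_iff' measurableSet_ball).1 h
    have hae' : (fun w => ‖charFun μ w - charFun ν w‖ ^ 2) =ᵐ[(volume : Measure F)] fun _ => 0 := by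
      have hall : ∀ᵐ w ∂(volume : Measure F), ∀ N : ℕ, w ∈ ball (0 : F) N →
          ‖charFun μ w - charFun ν w‖ ^ 2 = 0 := ae_all_iff.2 fun N => hae N
      filter_upwards [hall] with w hw
      obtain ⟨N, hN⟩ := exists_nat_gt ‖w‖
      exact hw N (by simpa using hN)
    have heq := Measure.eq_of_ae_eq hae' hcont continuous_const
    exact fun w => congrFun heq w
  refine Measure.ext_of_charFun (funext fun w => ?_)
  have hw := hzero w
  simp only [pow_eq_zero_iff, ne_eq, OfNat.ofNat_ne_zero, not_false_eq_true, norm_eq_zero,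
    sub_eq_zero] at hw
  exact hw

/-- **Identification of limits from vanishing renormalised Gaussian energy.**  Let `μ_n, λ_n` be finite
measures of total mass `≤ M` whose characteristic functions converge pointwise to those of `μ, λ`, and
`τ_n ≥ 1`.  If the Gaussian energy of `μ_n - λ_n` at temperature `τ_n`, renormalised by `(2πτ_n)^{d/2}`, tends to
zero — `(2πτ_n)^{d/2} ∫ ‖μ̂_n - λ̂_n‖² dγ_{τ_n} → 0` — then `μ = λ`.  (By `integral_norm_charFun_sub_sq_eq` the
renormalised energy is `(2πτ_n)^{d/2} [I_n(μ_n,μ_n) - 2 I_n(μ_n,λ_n) + I_n(λ_n,λ_n)]` with the UNNORMALISED kernel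
`e^{-(τ_n/2)‖z‖²}`, i.e. `(2π)^d` times the same combination for the normalised Gaussian `G_{1/τ_n}`.) [folklore] -/
theorem measure_eq_of_tendsto_gaussianEnergy (μs κs : ℕ → Measure F)
    (μ ν : Measure F) [IsFiniteMeasure μ] [IsFiniteMeasure ν] (hμs : ∀ n, IsFiniteMeasure (μs n))
    (hκs : ∀ n, IsFiniteMeasure (κs n)) {M : ℝ} (hμM : ∀ n, (μs n).real Set.univ ≤ M)
    (hkM : ∀ n, (κs n).real Set.univ ≤ M)
    (hμ : ∀ w, Tendsto (fun n => charFun (μs n) w) atTop (𝓝 (charFun μ w)))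
    (hν : ∀ w, Tendsto (fun n => charFun (κs n) w) atTop (𝓝 (charFun ν w)))
    (τ : ℕ → ℝ) (hτ1 : ∀ n, 1 ≤ τ n)
    (hE : Tendsto (fun n => (2 * π * τ n) ^ ((Module.finrank ℝ F : ℝ) / 2) *
      ∫ w, ‖charFun (μs n) w - charFun (κs n) w‖ ^ 2
        ∂((volume : Measure F).withDensity fun w => ENNReal.ofReal (localMaxwellian 1 (τ n) 0 w)))
      atTop (𝓝 0)) :
    μ = ν := by
  refine measure_eq_of_tendsto_setIntegral_norm_charFun_sub_sq μs κs μ ν hμs hκs hμM hkM hμ hν fun K => ?_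
  have hτ : ∀ n, 0 < τ n := fun n => lt_of_lt_of_le one_pos (hτ1 n)
  -- squeeze between `0` and `e^{K²/2}` times the renormalised energy
  set E : ℕ → ℝ := fun n => (2 * π * τ n) ^ ((Module.finrank ℝ F : ℝ) / 2) *
    ∫ w, ‖charFun (μs n) w - charFun (κs n) w‖ ^ 2
      ∂((volume : Measure F).withDensity fun w => ENNReal.ofReal (localMaxwellian 1 (τ n) 0 w)) with hEdef
  have hup : ∀ n, ∫ w in ball (0 : F) K, ‖charFun (μs n) w - charFun (κs n) w‖ ^ 2 ∂(volume : Measure F) ≤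
      Real.exp (K ^ 2 / 2) * E n := by
    intro n
    haveI := hμs n; haveI := hκs n
    have h0 : 0 ≤ M := le_trans measureReal_nonneg (hμM n)
    have h := setIntegral_ball_le_mul_integral_gaussian (hτ n) K
      (f := fun w => ‖charFun (μs n) w - charFun (κs n) w‖ ^ 2)
      ((continuous_charFun.sub continuous_charFun).norm.pow 2) (fun w => sq_nonneg _)
      (B := (M + M) ^ 2) (fun w => pow_le_pow_left₀ (norm_nonneg _)
        ((norm_sub_le _ _).trans (add_le_add ((norm_charFun_le w).trans (hμM n))
          ((norm_charFun_le w).trans (hkM n)))) 2)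
    refine h.trans ?_
    have hint : 0 ≤ ∫ w, ‖charFun (μs n) w - charFun (κs n) w‖ ^ 2
        ∂((volume : Measure F).withDensity fun w => ENNReal.ofReal (localMaxwellian 1 (τ n) 0 w)) :=
      integral_nonneg fun w => sq_nonneg _
    have hexp : Real.exp (K ^ 2 / (2 * τ n)) ≤ Real.exp (K ^ 2 / 2) :=
      Real.exp_le_exp.2 (div_le_div_of_nonneg_left (sq_nonneg K) (by norm_num) (by linarith [hτ1 n]))
    calc (2 * π * τ n) ^ ((Module.finrank ℝ F : ℝ) / 2) * Real.exp (K ^ 2 / (2 * τ n)) *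
          ∫ w, ‖charFun (μs n) w - charFun (κs n) w‖ ^ 2
            ∂((volume : Measure F).withDensity fun w => ENNReal.ofReal (localMaxwellian 1 (τ n) 0 w))
        ≤ (2 * π * τ n) ^ ((Module.finrank ℝ F : ℝ) / 2) * Real.exp (K ^ 2 / 2) *
          ∫ w, ‖charFun (μs n) w - charFun (κs n) w‖ ^ 2
            ∂((volume : Measure F).withDensity fun w => ENNReal.ofReal (localMaxwellian 1 (τ n) 0 w)) :=
          mul_le_mul_of_nonneg_right (mul_le_mul_of_nonneg_left hexp
            (Real.rpow_nonneg (mul_nonneg (by positivity) (hτ n).le) _)) hint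
      _ = Real.exp (K ^ 2 / 2) * E n := by rw [hEdef]; ring
  have hlim : Tendsto (fun n => Real.exp (K ^ 2 / 2) * E n) atTop (𝓝 0) := by
    simpa using hE.const_mul (Real.exp (K ^ 2 / 2))
  exact tendsto_of_tendsto_of_tendsto_of_le_of_le tendsto_const_nhds hlim
    (fun n => integral_nonneg fun w => sq_nonneg _) hup

end Identification

/-- **Registered sub-goal (pair space of the stub).**  On the Euclidean pair space `WithLp 2 (V3 × V3)`,
`V3 = ℝ³` (dimension `6`, renormalisation `(2πτ_n)³`): finite measures `μ_n, λ_n` of mass `≤ M` with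
characteristic functions converging pointwise to those of `μ, λ` and with vanishing renormalised Gaussian energy
of `μ_n - λ_n` at temperatures `τ_n ≥ 1` have `μ = λ`.  For `μ_n = √β_ω ν_n`, `λ_n = √β_ω (T̂_ω)_# ν_n` this is
the last step of the energy route to the diagonal collision invariance. [folklore] -/
theorem stub_diagonalParityRigidity_identification :
  ∀ (μs κs : ℕ → Measure (WithLp 2 (EuclideanSpace ℝ (Fin 3) × EuclideanSpace ℝ (Fin 3))))
    (μ ν : Measure (WithLp 2 (EuclideanSpace ℝ (Fin 3) × EuclideanSpace ℝ (Fin 3)))) (M : ℝ) (τ : ℕ → ℝ),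
    IsFiniteMeasure μ → IsFiniteMeasure ν → (∀ n, IsFiniteMeasure (μs n)) → (∀ n, IsFiniteMeasure (κs n)) →
    (∀ n, (μs n).real Set.univ ≤ M) → (∀ n, (κs n).real Set.univ ≤ M) →
    (∀ w, Tendsto (fun n => charFun (μs n) w) atTop (𝓝 (charFun μ w))) →
    (∀ w, Tendsto (fun n => charFun (κs n) w) atTop (𝓝 (charFun ν w))) →
    (∀ n, 1 ≤ τ n) →
    Tendsto (fun n => (2 * π * τ n) ^ (3 : ℝ) *
      ∫ w, ‖charFun (μs n) w - charFun (κs n) w‖ ^ 2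
        ∂((volume : Measure (WithLp 2 (EuclideanSpace ℝ (Fin 3) × EuclideanSpace ℝ (Fin 3)))).withDensity
          fun w => ENNReal.ofReal (localMaxwellian 1 (τ n) 0 w))) atTop (𝓝 0) →
    μ = ν :=
  fun μs κs μ ν _ τ hμ hν hμs hκs hμM hkM hcμ hcν hτ1 hE => by
    haveI := hμ; haveI := hν
    refine measure_eq_of_tendsto_gaussianEnergy μs κs μ ν hμs hκs hμM hkM hcμ hcν τ hτ1 ?_
    have hd : ((Module.finrank ℝ (WithLp 2 (EuclideanSpace ℝ (Fin 3) × EuclideanSpace ℝ (Fin 3))) : ℝ) / 2)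
        = 3 := by
      rw [(WithLp.linearEquiv 2 ℝ (EuclideanSpace ℝ (Fin 3) × EuclideanSpace ℝ (Fin 3))).finrank_eq,
        Module.finrank_prod, finrank_euclideanSpace_fin]
      norm_num
    simpa only [hd] using hE

end Summit.AtomisticToContinuum.HydrodynamicLimit.Theorems.EvenStressEnskog

end
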